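import Literature.AlgebraicGeometry.AbelianSchemes.AbelianSchemeKOfLConstantOfLevelStructure
import Literature.AlgebraicGeometry.AbelianSchemes.AbelianSchemeKOfLBaseChange
import Literature.AlgebraicGeometry.AbelianSchemes.LevelBasisFiniteEtaleCover
import Literature.AlgebraicGeometry.AbelianSchemes.AbelianSchemeOverHomNoetherianAnyBase
import Literature.AlgebraicGeometry.AbelianSchemes.AbelianSchemeOverLevelBaseChange
import HarnessLib

/-!
# `K(L)` over a connected level cover: the finite constant subgroup of sections (letter (Ma)'s `K′`-clause)

Layer `Literature/AlgebraicGeometry/AbelianSchemes`, namespace `Literature.AlgebraicGeometry.AbelianSchemes.AbelianSchemeOver`.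
THEOREMS ONLY (no definition, no named fact, no instance, no notation, no `sorry`).  Cell `hodgecm-mathlib` (D-0151),
FLOOR-0 programme P1, F-3 child line (M) `Cruxes/HDel/Lines/F3DualAbelianSchemeM`, letter (Ma) `stub_F3Ma` ed. 4
(B-typ04 (g15) 8047f009; B-plan1 (g19) ruling r-conn 2026-08-30 19:36Z; (Ma) lead B-p02 (g16) road (r1′) 19:58Z: `S′ :=`
a CONNECTED component of the level-`M`-basis torsor, (Ma0-conn)).  This file is the `K′`-CLAUSE PACKAGE of that letter
(B-p19 (g18) brick 4, TAKING 20:00Z): everything after the ∃-prefix `S′, p, G, ρ, ρA, …` — which the (Ma) assembler gets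
from (Ma0-conn) (B-p02 (g16)) and ★-in-HOME (E7) `exists_actionOver_baseChange` (B-p13 (g21)).  Author B-p19 (g18);
count-neutral capital.  HC_CM is proved only modulo the 7 printed citations until rung 0 closes; nothing here is about HC.

## Statement ([MumfordAV1970] §13 «`Â := A⁄K(L)`» made étale-local; [MumfordFogartyKirwan1994] Ch. 7 §2 Prop. 7.3 (IV))

`A → S` an abelian scheme, `L` of rank one rigidified along the unit section, `K(L)` represented by a closed immersion
`i : Z ↪ A` with `Z → S` étale and KILLED BY `M` (`i ^ M = 1`: the (K) hand's ★-in-HOME (T3)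
`exists_pow_eq_one_of_formallyUnramified`, B-p08 (g15)); `p : S′ → S` with `S′` CONNECTED, locally Noetherian, `M`
invertible in its residue fields, and a level-`M` structure `φ` on `A′ := A ×_S S′` (★-in-HOME (Ma0-conn), B-p02 (g16)).
Then there is a FINITE subgroup `K′ ≤ A′(S′)` — namely `K(L′)(S′)`, `L′ := L|_{A′}` — whose non-trivial members are
everywhere non-trivial on geometric fibres (the freeness input of (Mb)), and such that a `T`-point `u` of `A′` lies in
`K(L′)(T)` iff it is, locally on `T`, the restriction of a member of `K′` — TOKEN-SHAPED as the last block of `stub_F3Ma`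
ed. 4.  Assembly: ★-in-HOME brick 4a `IsBaseChangeVia.exists_represents_memKOfL_pullback` ∕ `…pow_eq_one_of_memKOfL_pullback`
∕ `…pullback_unitSection_detClass_pullback_eq_one` (`K(L)` commutes with base change), ★ `exists_torsion_subscheme`
(`A′[M]`), ★ `isCommMonObj_of_isLocallyNoetherian_base`, and ★-in-HOME brick 2
`finite_kOfL_and_injective_restrict_and_memKOfL_iff_of_levelStructure`.

## References
* [MumfordAV1970] D. Mumford, *Abelian Varieties* (1970), §13 (p. 123) and §7 Thm. 4 (p. 72).
* [MumfordFogartyKirwan1994] D. Mumford, J. Fogarty, F. Kirwan, *Geometric Invariant Theory*, 3rd ed. (1994), Ch. 7 §2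
  Proposition 7.3, proof, step (IV) (pp. 133–134); Ch. 7 §3 Lemma 7.11 (p. 140).
* [GortzWedhorn2023] U. Görtz, T. Wedhorn, *Algebraic Geometry II* (2023), Prop. 27.188 (1) (p. 675).
-/

noncomputable section

universe u

open CategoryTheory CategoryTheory.Limits AlgebraicGeometry MonoidalCategory CartesianMonoidalCategory

open scoped MonObj Obj

namespace Literature.AlgebraicGeometry.AbelianSchemes

open Literature.AlgebraicGeometry.Modules Literature.AlgebraicGeometry.Motives Literature.AlgebraicGeometry.AbelianVarieties
  Literature.AlgebraicGeometry.Morphisms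

namespace AbelianSchemeOver

variable {S : Scheme.{u}} (A : AbelianSchemeOver S)

/-- **Letter (Ma)'s `K′`-clause over a connected level cover.**  Hypotheses: `L` of rank one with `ε^*[L] = 1`;
`K(L)` represented by `i : Z ↪ A`, a closed immersion with `Z → S` étale, and `i ^ M = 1` (`M ≠ 0`); `p : S′ → S` with
`S′` connected and locally Noetherian, `M` invertible in the residue fields of `S′`; a level-`M` structure on `A ×_S S′`.
Conclusion (token-shaped as `stub_F3Ma` ed. 4): a FINITE subgroup `K′` of sections of `A ×_S S′` such that (freeness)
`σ ∈ K′`, `σ ≠ 1` ⇒ `σ(s̄) ≠ 1` at every geometric point `s̄` of `S′`, and (constancy) `u ∈ K(L|_{A ×_S S′})(T)` iff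
there is an open cover of `T` on whose members `u` is the restriction of a member of `K′`.
[cite: MumfordAV1970, §13 (p. 123)] [cite: MumfordFogartyKirwan1994, Ch. 7 §2 Proposition 7.3, proof step (IV) (pp. 133–134)]
[cite: GortzWedhorn2023, Prop. 27.188 (1) (p. 675)] -/
theorem exists_finite_subgroup_memKOfL_iff_baseChange (L : A.left.Modules) (hL : HasRank L 1)
    (hε : CechPic.pullback A.unitSection (detClass (HasRank.isFiniteLocallyFree' hL)) = 1)
    {Z : Over S} (i : Z ⟶ A.X) [IsClosedImmersion i.left] [Etale Z.hom]
    (hZ : ∀ (T : Over S) (u : T ⟶ A.X), (∃ v : T ⟶ Z, v ≫ i = u) ↔ A.MemKOfL L u)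
    {M : ℕ} [NeZero M] (hin : i ^ M = 1)
    {S' : Scheme.{u}} (p : S' ⟶ S) [IsLocallyNoetherian S'] [ConnectedSpace S']
    (hM : ∀ s : S', (M : S'.residueField s) ≠ 0) {g : ℕ} (φ : LevelStructure g M (A.baseChange p)) :
    ∃ (K' : Subgroup (A.baseChange p).Sections) (_ : Finite K'),
      (∀ (Ω : Type u) [Field Ω] [IsAlgClosed Ω] (s : Spec (.of Ω) ⟶ S') (σ : (A.baseChange p).Sections),
          σ ∈ K' → σ ≠ 1 → (A.baseChange p).restrict s σ ≠ (A.baseChange p).restrict s 1) ∧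
      ∀ (T : Over S') (u : T ⟶ (A.baseChange p).X),
        (A.baseChange p).MemKOfL ((Scheme.Modules.pullback (pullback.fst A.X.hom p)).obj L) u ↔
          ∃ 𝒱 : Scheme.OpenCover.{u} T.left, ∀ j, ∃ σ : K',
            𝒱.f j ≫ u.left = 𝒱.f j ≫ T.hom ≫ (σ : (A.baseChange p).Sections).left := by
  classical
  have hbc : (A.baseChange p).IsBaseChangeVia A p (pullback.fst A.X.hom p) := A.baseChange_isBaseChangeVia p
  haveI : IsCommMonObj (A.baseChange p).X := (A.baseChange p).isCommMonObj_of_isLocallyNoetherian_base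
  have hL' : HasRank ((Scheme.Modules.pullback (pullback.fst A.X.hom p)).obj L) 1 :=
    hasRank_pullback (pullback.fst A.X.hom p) hL
  have hε' := hbc.pullback_unitSection_detClass_pullback_eq_one hL hε
  obtain ⟨Z', i', hci', het', hZ'⟩ := hbc.exists_represents_memKOfL_pullback hL i hZ
  haveI := hci'
  haveI := het'
  have hKM' : ∀ (T : Over S') (u : T ⟶ (A.baseChange p).X),
      (A.baseChange p).MemKOfL ((Scheme.Modules.pullback (pullback.fst A.X.hom p)).obj L) u → u ^ M = 1 :=
    fun T u hu => hbc.pow_eq_one_of_memKOfL_pullback hL i hZ hin u hu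
  obtain ⟨AM, incl, hfin, het, hpow, hlift, hinj⟩ := (A.baseChange p).exists_torsion_subscheme hM
  haveI := hfin
  haveI := het
  obtain ⟨hfinK, hinjK, hiff⟩ :=
    (A.baseChange p).finite_kOfL_and_injective_restrict_and_memKOfL_iff_of_levelStructure _ hL' hε' φ incl hpow
      hlift hinj i' hZ' hKM'
  refine ⟨_, hfinK, ?_, hiff⟩
  intro Ω _ _ s σ hσ hne heq
  apply hne
  have h1 : (1 : (A.baseChange p).Sections) ∈ (A.baseChange p).kOfL _ hL' hε' (𝟙_ (Over S')) := Subgroup.one_mem _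
  have := @hinjK Ω _ _ s ⟨σ, hσ⟩ ⟨1, h1⟩ heq
  exact congrArg Subtype.val this

end AbelianSchemeOver

end Literature.AlgebraicGeometry.AbelianSchemes

end
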